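import Literature.MathematicalPhysics.QuantumFieldTheory.Balaban1983to89.B9Thm311SmallFieldClosed
import Literature.MathematicalPhysics.QuantumFieldTheory.Balaban1983to89.B9Ineq369CurvatureOperatorBound

/-!
# `Balaban1983to89.B9Eq384LaplaceALipschitz` — T. Bałaban, *Propagators for lattice gauge theories in a background field*, Commun. Math. Phys. **99**
# (1985) 389–434 [Balaban1985BackgroundPropagators] (3.82)–(3.84) p. 407 with Thm 3.4 p. 400: AT A FIXED LATTICE THE pub-balaban NE9 CHAIN'S ASSEMBLED
# `Δ_a(U)` IS LIPSCHITZ IN THE BACKGROUND AT THE FLAT POINT — «Δ_a(U′U) = Δ_a(U) − V(A)» with `‖V‖ ≤ C_Δ·ε` for `‖U(b) − 1‖ ≤ ε ≤ ε₆` (L² operator norm):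
# the remainder of `B9Thm311SmallFieldCoercivity` ((3.82)) in LINEAR form, the averaging letters of NE9 leaf-03/leaf-04 and the curvature bound inserted

statement-level skeleton of published theorems with citation tags; proofs where landed; nothing here is a claim about the Yang–Mills mass gap

PDF held: `paper:balaban1985-cmp99-background-propagators` (journal page = PDF page + 388), pp. 400, 404–407, 416 read by this seat (2026-08-22).

THE PRINT (first-hand, text layer p. 407; «P₁(A),» restored from the render p019 — the text layer drops it at a line break, reader ne9-leaf-06 g60).
*«The operators V₃(A), P₁(A), P₂(A) depend analytically on A in the domain (3.37). Let us denote the sum of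
these three operators by V(A). We can write (3.82) as Δ_a(U′U) = Δ_a(U) − V(A) = (I − V(A)G(U))Δ_a(U). (3.84)»* (the three operators: V₃(A),
P₁(A), P₂(A) of (3.82) «Δ_a(U′U) = … = Δ_a(U) − V₃(A) − P₁(A) − P₂(A)»); p. 400, Thm 3.4: *«… describing these analytic extensions as small
perturbations of the operators depending on U only»*.
(DOCFIX, gen 81, docstring-only — statements and proofs byte-identical: the v1 header's «verbatim» quotations were
paraphrases (reader ne9-leaf-02 g57 R-ne9leaf02-g57-1); replaced by the text layer's words, read first-hand.)

WHY THIS FILE (cell context).  Generations 79–81 of the pub-balaban NE9 owner lineage made the chain's `Δ_a(U)` positive at every small field of a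
fixed lattice (`B9Thm311SmallFieldClosed`) from the remainder estimate `B9Thm311SmallFieldCoercivity.norm_principalGF_sub_flat_le` ((3.82) for the
principal gauge-fixed operator, with an explicit but non-linear constant).  For the CONTINUITY of the chain's letters in the background (the next display
toward the curve species as a family in `U`; consumed by `B9Eq386LipschitzH1`) one needs the remainder LINEAR in `ε = sup_b ‖U(b) − 1‖`: this file redoes
the §6 bookkeeping of `B9Thm311SmallFieldCoercivity` keeping the conclusion as a norm bound, inserts the averaging letters (`ρ′` by NE9 leaf-03's
`B9Eq319QprimeLipschitz`, `δ_Q` by NE9 leaf-04's `B9Eq315QLipschitz`, `εR = 2M_φM_φ′ε`) and adds the curvature part (`B9Ineq369CurvatureOperatorBound`,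
`Δ′(1) = 0`).

WHAT IS PROVED (sorry-free; no `Prop` placeholder; no inequality of the paper asserted).
* **`exists_principalGF_sub_flat_linear`** — (3.82) for the chain's PRINCIPAL gauge-fixed operator in LINEAR form: `∃ K ε₀ > 0` such that for every
  background of E162's data with `U(b) ∈ U1`, `‖U(b) − 1‖ ≤ ε`, `hRS`, averaging letters `ρ′`, `δ_Q` and `ε + ρ′ + δ_Q ≤ ε₀`:
  `‖(D*D + DR(U)D* + aQ(U)*Q(U))x − (∂*∂ + ∂R(1)∂* + aQ(1)*Q(1))x‖ ≤ K·(ε + ρ′ + δ_Q)·‖x‖`.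
* **`exists_laplaceAofBackground_sub_flat_le`** — `∃ C_Δ ε₆ > 0 ∀ U` (E162 data, `‖U(b) − 1‖ ≤ ε ≤ ε₆`, `hRS`) `∀ x`, `‖Δ_a(U)x − Δ_a(1)x‖ ≤ C_Δ·ε·‖x‖` —
  (3.84) with `‖V‖ = O(ε)` for the chain's ASSEMBLED `Δ_a = Δ(U) + DR(U)D* + aQ(U)*Q(U)`.
MODEL / HONEST SCOPE.  [folklore] finite-dimensional bookkeeping at a FIXED lattice; `K, ε₀, C_Δ, ε₆` depend on `L, m, η, c₀, c₁, a`, `M_φ, M_φ′, C_τ`;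
Lipschitz AT THE FLAT POINT only (the remainders of `B9Eq373DerivativeRemainderL2` are relative to the flat transporters) — NOT between two general small
fields, NOT analyticity in `A` (print's `V(A)` analytic), NOT print's uniformity in the lattice; NOT summit progress (cell pub-balaban: NE9 NOT PRINTED / NOT
PROVED; spine PROVED 0/9; rung (B)+1 finite T⁴ — NOT infinite volume, NOT mass gap, NOT BetaPertH, NOT Clay).  HONEST DEPENDENCY (cell line): continuum YM
on T⁴ ⇐ BetaPertH ∧ nine spine estimates (0/9 proved); BetaPertH ⇐ (D1) ∧ (D4) ∧ CAP+tail; G-an2-4 gates asym, D1 and NE2/3/4.  Filed by the pub-balaban NE9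
BINDER-row owner lineage `b2b-balaban-t4-ne9-p1` (gen 81); NEW file importing `B9Thm311SmallFieldClosed`, `B9Ineq369CurvatureOperatorBound` only; nothing
modified.  Net new unproved facts: 0.
-/

noncomputable section

open scoped InnerProductSpace ComplexConjugate

namespace Literature.MathematicalPhysics.QuantumFieldTheory.Balaban1983to89.B9Eq384LaplaceALipschitz

open B4Sect5Torus (TSite)
open B9SectCLatticeCarrier (Bond)
open B7Prop1Explicit (U1 Wcx boxVec)
open B9Eq311L2Pairing (WL2)
open B9Eq319QprimeTorus (fineP centre weight)
open B9Eq319Onto (centreFun)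
open B11Eq103H1Complex (SiteL2K BondL2K covDerivL2K covDivL2K covLaplaceSiteK laplaceAK laplaceAK_apply laplaceALatticeK H1LatticeK G1LatticeK
  adjoint_injective_of_surjective)
open B9Eq310HessianOperator (adTransportW principalOpK hessOp hessOp_apply curvOp curvOp_one)
open B9Eq310DeltaPrime (plaqHolU)
open B9Eq326OperatorAssembly (RofU QprimeW)
open B9Eq315QTorus (perCfg cornerSite QtorusW laplaceAofBackground)
open B9Eq315QTorusOnto (liftSite perSite_liftSite QtorusW_surjective)
open B5Eq172FlatCoercivity (hU1_one hreg_one)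
open B9Eq373DerivativeRemainderL2 (norm_adjoint_apply_le)
open B9Eq384RemainderLetters (norm_centre_le norm_adTransportW_sub_le hRS_one)
open B9Eq323FlatBlockPoincare (exists_flat_modulus_explicit)
open B9Thm311SmallFieldCoercivity (norm_principalGF_sub_flat_le)
open B9Eq319QprimeLipschitz (norm_QprimeW_sub_flat_le_L2 rho_le)
open B9Eq315QLipschitz (norm_QtorusW_sub_flat_le)
open B9Thm311SmallFieldClosed (norm_plaqHolU_sub_one_le)
open B9Ineq369CurvatureOperatorBound (norm_curvOp_le)

/-- arithmetic helper: `B·t ≤ μ/2` when `t ≤ μ/(2B + 1)`. [folklore] -/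
private theorem mul_le_half_of_le_div {B μ t : ℝ} (hB : 0 ≤ B) (hμ : 0 ≤ μ) (ht : t ≤ μ / (2 * B + 1)) : B * t ≤ μ / 2 := by
  have h1 : B * t ≤ B * (μ / (2 * B + 1)) := mul_le_mul_of_nonneg_left ht hB
  have h2 : B * (μ / (2 * B + 1)) ≤ μ / 2 := by
    rw [mul_div_assoc', div_le_div_iff₀ (by positivity) (by norm_num)]; nlinarith
  exact h1.trans h2

variable {d : ℕ} (L : ℕ) [NeZero L] (m : Fin d → ℕ) [∀ i, NeZero (fineP L m i)] (hL : 1 ≤ L)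
  {𝔸 : Type*} [NormedRing 𝔸] [NormedAlgebra ℂ 𝔸] [CompleteSpace 𝔸] [NormOneClass 𝔸]
  {W : Type*} [NormedAddCommGroup W] [InnerProductSpace ℂ W] [FiniteDimensional ℂ W] (φ : W ≃ₗ[ℂ] 𝔸) {c₀ c₁ : ℝ} [Fact (0 < c₀)] [Fact (0 < c₁)]

/-! ## §1 (3.82) for the chain's principal gauge-fixed operator, LINEAR form -/

set_option maxHeartbeats 400000 in
/-- **(3.82)∕(3.84) FOR THE CHAIN'S PRINCIPAL GAUGE-FIXED OPERATOR, LINEAR IN THE SMALLNESS LETTERS**: there are `K, ε₀ > 0` (finite-lattice numbers)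
such that for every background `U` of E162's data with `U(b) ∈ U1`, `‖U(b) − 1‖ ≤ ε`, `hRS`, averaging letters `‖Q′(U)λ − Q′(1)λ‖ ≤ ρ′‖λ‖`,
`‖Q(U)x − Q(1)x‖ ≤ δ_Q‖x‖` and `ε + ρ′ + δ_Q ≤ ε₀`: `‖P(U)x − P(1)x‖ ≤ K·(ε + ρ′ + δ_Q)·‖x‖` for `P(V) = D*D + DR(V)D* + aQ(V)*Q(V)` — the constant of
`B9Thm311SmallFieldCoercivity.norm_principalGF_sub_flat_le` bounded linearly (its §6 bookkeeping, with the conclusion kept as a NORM bound).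
[cite: Balaban1985BackgroundPropagators, (3.82)–(3.84) p.407, (3.70)–(3.77) pp.404–406] -/
theorem exists_principalGF_sub_flat_linear {η : ℝ} (hη : η ≠ 0) (a : ℝ) {Mφ Mφ' : ℝ} (hMφ : 0 ≤ Mφ) (hMφ' : 0 ≤ Mφ')
    (hφ : ∀ w, ‖φ w‖ ≤ Mφ * ‖w‖) (hφ' : ∀ X, ‖φ.symm X‖ ≤ Mφ' * ‖X‖) :
    ∃ K ε₀ : ℝ, 0 < K ∧ 0 < ε₀ ∧ ∀ (U : Bond d (fineP L m) → 𝔸ˣ) {α : ℝ} (hα1 : α ≤ 1 / 64)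
      (hU1 : ∀ (x : B7Prop1Explicit.Site d) (κ : Fin d), perCfg (fineP L m) U x κ ∈ U1 𝔸)
      (hreg : ∀ (y : TSite d m) (κ : Fin d) (r : Fin d → Fin L), ‖((Wcx L (perCfg (fineP L m) U) (cornerSite L y) κ (boxVec L r) : 𝔸ˣ) : 𝔸) - 1‖ ≤ α)
      {ε ρ' δQ : ℝ}, 0 ≤ ε → 0 ≤ ρ' → 0 ≤ δQ → ε + ρ' + δQ ≤ ε₀ →
      (∀ b, U b ∈ U1 𝔸) → (∀ b, ‖(U b : 𝔸) - 1‖ ≤ ε) →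
      (∀ (b : Bond d (fineP L m)) (v u : W), ⟪adTransportW φ U b v, u⟫_ℂ = ⟪v, adTransportW φ (fun b => (U b)⁻¹) b u⟫_ℂ) →
      (∀ l : SiteL2K ℂ d (fineP L m) c₀ W, ‖QprimeW L m φ U l - QprimeW L m φ (fun _ : Bond d (fineP L m) => (1 : 𝔸ˣ)) l‖ ≤ ρ' * ‖l‖) →
      (∀ x : BondL2K ℂ d (fineP L m) c₀ W, ‖QtorusW L m hL φ U hα1 hU1 hreg (c₁ := c₁) x -
        QtorusW L m hL φ (fun _ => 1) (show (0 : ℝ) ≤ 1 / 64 by norm_num) (hU1_one L m) (hreg_one L m) (c₁ := c₁) x‖ ≤ δQ * ‖x‖) →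
      ∀ x : BondL2K ℂ d (fineP L m) c₀ W,
        ‖laplaceALatticeK ((η : ℂ))⁻¹ (adTransportW φ U) (adTransportW φ fun b => (U b)⁻¹) (principalOpK φ η U) (RofU L m φ η U)
            (QtorusW L m hL φ U hα1 hU1 hreg (c₁ := c₁)) a x -
          laplaceALatticeK ((η : ℂ))⁻¹ (adTransportW φ (fun _ : Bond d (fineP L m) => (1 : 𝔸ˣ)))
            (adTransportW φ fun _ : Bond d (fineP L m) => (1 : 𝔸ˣ)⁻¹) (principalOpK φ η fun _ => 1) (RofU L m φ η fun _ => 1)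
            (QtorusW L m hL φ (fun _ => 1) (show (0 : ℝ) ≤ 1 / 64 by norm_num) (hU1_one L m) (hreg_one L m) (c₁ := c₁)) a x‖ ≤
        K * (ε + ρ' + δQ) * ‖x‖ := by
  have hc₀ : 0 < c₀ := Fact.out
  -- the flat constants: `μ` (flat modulus), `MQ = ‖Q(1)‖`
  obtain ⟨μ, hμ, hmod⟩ := exists_flat_modulus_explicit L m φ (c₀ := c₀) hη
  obtain ⟨MQ, hMQdef⟩ : ∃ MQ : ℝ, MQ = ‖LinearMap.toContinuousLinearMap
    (QtorusW L m hL φ (fun _ => 1) (show (0 : ℝ) ≤ 1 / 64 by norm_num) (hU1_one L m) (hreg_one L m) (c₀ := c₀) (c₁ := c₁))‖ := ⟨_, rfl⟩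
  have hMQ : 0 ≤ MQ := by
    rw [hMQdef]
    exact norm_nonneg (LinearMap.toContinuousLinearMap
      (QtorusW L m hL φ (fun _ => 1) (show (0 : ℝ) ≤ 1 / 64 by norm_num) (hU1_one L m) (hreg_one L m) (c₀ := c₀) (c₁ := c₁)))
  have hQ₁ : ∀ x : BondL2K ℂ d (fineP L m) c₀ W,
      ‖QtorusW L m hL φ (fun _ => 1) (show (0 : ℝ) ≤ 1 / 64 by norm_num) (hU1_one L m) (hreg_one L m) (c₀ := c₀) (c₁ := c₁) x‖ ≤ MQ * ‖x‖ :=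
    fun x => by
      rw [hMQdef]
      exact (LinearMap.toContinuousLinearMap
        (QtorusW L m hL φ (fun _ => 1) (show (0 : ℝ) ≤ 1 / 64 by norm_num) (hU1_one L m) (hreg_one L m) (c₀ := c₀) (c₁ := c₁))).le_opNorm x
  -- the lattice constants
  have hnc : 0 ≤ ‖((η : ℂ))⁻¹‖ := norm_nonneg _
  obtain ⟨KR, hKRdef⟩ : ∃ KR : ℝ, KR = 2 * Mφ * Mφ' := ⟨_, rfl⟩
  have hKR : 0 ≤ KR := by rw [hKRdef]; positivity
  obtain ⟨CS, hCSdef⟩ : ∃ CS : ℝ, CS = (L : ℝ) ^ d * Real.sqrt (c₀ * Fintype.card (TSite d (fineP L m))) := ⟨_, rfl⟩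
  have hCS : 0 ≤ CS := by rw [hCSdef]; positivity
  obtain ⟨B, hBdef⟩ : ∃ B : ℝ, B = μ * CS + 6 * ‖((η : ℂ))⁻¹‖ ^ 2 * d * KR + 16 * ‖((η : ℂ))⁻¹‖ ^ 2 * d * CS := ⟨_, rfl⟩
  have hB : 0 ≤ B := by rw [hBdef]; positivity
  obtain ⟨K, hKdef⟩ : ∃ K : ℝ, K = 48 * d * ‖((η : ℂ))⁻¹‖ ^ 2 * KR + 8 * ‖((η : ℂ))⁻¹‖ ^ 2 * d * KR + 64 * ‖((η : ℂ))⁻¹‖ ^ 2 * d * (6 * ‖((η : ℂ))⁻¹‖ ^ 2 * d * KR + 16 * ‖((η : ℂ))⁻¹‖ ^ 2 * d * CS) / μ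
    + |a| * (2 * MQ + 1) + 1 := ⟨_, rfl⟩
  have hK : 0 < K := by rw [hKdef]; positivity
  refine ⟨K, min (1 / (KR + 1)) (μ / (2 * B + 1)), hK, by positivity, ?_⟩
  intro U α hα1 hU1 hreg ε ρ' δQ hε hρ' hδQ ht hUb hUε hRS hQ' hQ x
  -- `t = ε + ρ′ + δ_Q` and its consequences
  have ht1 : ε + ρ' + δQ ≤ 1 / (KR + 1) := ht.trans (min_le_left _ _)
  have ht2 : ε + ρ' + δQ ≤ μ / (2 * B + 1) := ht.trans (min_le_right _ _)
  have hεt : ε ≤ ε + ρ' + δQ := by linarith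
  have hρt : ρ' ≤ ε + ρ' + δQ := by linarith
  have hδQt : δQ ≤ ε + ρ' + δQ := by linarith
  have ht01 : ε + ρ' + δQ ≤ 1 := ht1.trans (by rw [div_le_one (by positivity)]; linarith)
  have hδQ1 : δQ ≤ 1 := hδQt.trans ht01
  have ht0 : 0 ≤ ε + ρ' + δQ := by positivity
  -- the letters of `norm_principalGF_sub_flat_le`
  obtain ⟨εR, hεRdef⟩ : ∃ εR : ℝ, εR = KR * ε := ⟨_, rfl⟩
  have hεR : 0 ≤ εR := by rw [hεRdef]; positivity
  have hεRt : εR ≤ KR * (ε + ρ' + δQ) := by rw [hεRdef]; exact mul_le_mul_of_nonneg_left hεt hKR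
  have hεR1 : εR ≤ 1 := by
    refine hεRt.trans ((mul_le_mul_of_nonneg_left ht1 hKR).trans ?_)
    rw [mul_one_div, div_le_one (by positivity)]; linarith
  have hR : ∀ (b : Bond d (fineP L m)) (w : W), ‖adTransportW φ U b w - w‖ ≤ εR * ‖w‖ := fun b w => by
    have h := norm_adTransportW_sub_le φ hφ hφ' hMφ' U b (hUb b) (hUε b) w
    rw [hεRdef, hKRdef]; linarith
  obtain ⟨ρ, hρdef⟩ : ∃ ρ : ℝ, ρ = CS * ρ' := ⟨_, rfl⟩
  have hρ0 : 0 ≤ ρ := by rw [hρdef]; positivity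
  have hρ : ∀ l : SiteL2K ℂ d (fineP L m) c₀ W,
      ‖(WL2.equiv ℂ (fun _ : TSite d (fineP L m) => c₀) W).symm (centreFun (weight L m) (centre L m)
        (QprimeW L m φ U l - QprimeW L m φ (fun _ : Bond d (fineP L m) => (1 : 𝔸ˣ)) l))‖ ≤ ρ * ‖l‖ := fun l =>
    (norm_centre_le L m _).trans (by
      rw [← hCSdef]
      calc CS * ‖QprimeW L m φ U l - QprimeW L m φ (fun _ : Bond d (fineP L m) => (1 : 𝔸ˣ)) l‖ ≤ CS * (ρ' * ‖l‖) :=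
            mul_le_mul_of_nonneg_left (hQ' l) hCS
        _ = ρ * ‖l‖ := by rw [hρdef]; ring)
  have hρt : ρ ≤ CS * (ε + ρ' + δQ) := by rw [hρdef]; exact mul_le_mul_of_nonneg_left hρt hCS
  -- smallness bookkeeping: `εΔ + Mρ + μρ ≤ B·t ≤ μ/2`
  have hd0 : (0 : ℝ) ≤ d := Nat.cast_nonneg d
  have hsd : Real.sqrt d * Real.sqrt d = d := Real.mul_self_sqrt hd0
  have hεΔ : 2 * (2 + εR) * ‖((η : ℂ))⁻¹‖ ^ 2 * d * εR ≤ 6 * ‖((η : ℂ))⁻¹‖ ^ 2 * d * KR * (ε + ρ' + δQ) := by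
    have h1 : 2 * (2 + εR) ≤ 6 := by linarith
    calc 2 * (2 + εR) * ‖((η : ℂ))⁻¹‖ ^ 2 * d * εR = (2 * (2 + εR)) * (‖((η : ℂ))⁻¹‖ ^ 2 * d * εR) := by ring
      _ ≤ 6 * (‖((η : ℂ))⁻¹‖ ^ 2 * d * (KR * (ε + ρ' + δQ))) :=
          mul_le_mul h1 (mul_le_mul_of_nonneg_left hεRt (by positivity)) (by positivity) (by norm_num)
      _ = 6 * ‖((η : ℂ))⁻¹‖ ^ 2 * d * KR * (ε + ρ' + δQ) := by ring
  have hM16 : 4 * (1 + εR) ^ 2 * ‖((η : ℂ))⁻¹‖ ^ 2 * d ≤ 16 * ‖((η : ℂ))⁻¹‖ ^ 2 * d := by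
    have h1 : (1 + εR) ^ 2 ≤ 4 := by
      calc (1 + εR) ^ 2 ≤ 2 ^ 2 := pow_le_pow_left₀ (by positivity) (by linarith) 2
        _ = 4 := by norm_num
    calc 4 * (1 + εR) ^ 2 * ‖((η : ℂ))⁻¹‖ ^ 2 * d = (1 + εR) ^ 2 * (4 * ‖((η : ℂ))⁻¹‖ ^ 2 * d) := by ring
      _ ≤ 4 * (4 * ‖((η : ℂ))⁻¹‖ ^ 2 * d) := mul_le_mul_of_nonneg_right h1 (by positivity)
      _ = 16 * ‖((η : ℂ))⁻¹‖ ^ 2 * d := by ring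
  have hMρ : 4 * (1 + εR) ^ 2 * ‖((η : ℂ))⁻¹‖ ^ 2 * d * ρ ≤ 16 * ‖((η : ℂ))⁻¹‖ ^ 2 * d * CS * (ε + ρ' + δQ) :=
    calc 4 * (1 + εR) ^ 2 * ‖((η : ℂ))⁻¹‖ ^ 2 * d * ρ ≤ 16 * ‖((η : ℂ))⁻¹‖ ^ 2 * d * ρ := mul_le_mul_of_nonneg_right hM16 hρ0
      _ ≤ 16 * ‖((η : ℂ))⁻¹‖ ^ 2 * d * (CS * (ε + ρ' + δQ)) := mul_le_mul_of_nonneg_left hρt (by positivity)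
      _ = 16 * ‖((η : ℂ))⁻¹‖ ^ 2 * d * CS * (ε + ρ' + δQ) := by ring
  have hμρ : μ * ρ ≤ μ * CS * (ε + ρ' + δQ) := by
    rw [mul_assoc]; exact mul_le_mul_of_nonneg_left hρt hμ.le
  have hBt : B * (ε + ρ' + δQ) ≤ μ / 2 := mul_le_half_of_le_div hB hμ.le ht2
  have hsum : μ * ρ + (2 * (2 + εR) * ‖((η : ℂ))⁻¹‖ ^ 2 * d * εR + 4 * (1 + εR) ^ 2 * ‖((η : ℂ))⁻¹‖ ^ 2 * d * ρ) ≤ μ / 2 := by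
    have : μ * CS * (ε + ρ' + δQ) + (6 * ‖((η : ℂ))⁻¹‖ ^ 2 * d * KR * (ε + ρ' + δQ) + 16 * ‖((η : ℂ))⁻¹‖ ^ 2 * d * CS * (ε + ρ' + δQ)) = B * (ε + ρ' + δQ) := by
      rw [hBdef]; ring
    linarith [hμρ, hεΔ, hMρ]
  have hrew : μ * (1 - ρ) - (2 * (2 + εR) * ‖((η : ℂ))⁻¹‖ ^ 2 * d * εR + 4 * (1 + εR) ^ 2 * ‖((η : ℂ))⁻¹‖ ^ 2 * d * ρ) =
      μ - (μ * ρ + (2 * (2 + εR) * ‖((η : ℂ))⁻¹‖ ^ 2 * d * εR + 4 * (1 + εR) ^ 2 * ‖((η : ℂ))⁻¹‖ ^ 2 * d * ρ)) := by ring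
  have hν2 : μ / 2 ≤ μ * (1 - ρ) - (2 * (2 + εR) * ‖((η : ℂ))⁻¹‖ ^ 2 * d * εR + 4 * (1 + εR) ^ 2 * ‖((η : ℂ))⁻¹‖ ^ 2 * d * ρ) := by
    rw [hrew]; linarith
  have hν : 0 < μ * (1 - ρ) - (2 * (2 + εR) * ‖((η : ℂ))⁻¹‖ ^ 2 * d * εR + 4 * (1 + εR) ^ 2 * ‖((η : ℂ))⁻¹‖ ^ 2 * d * ρ) :=
    lt_of_lt_of_le (by positivity) hν2
  -- the `R`-remainder
  have hδR : 2 * (2 * (2 + εR) * ‖((η : ℂ))⁻¹‖ ^ 2 * d * εR + 4 * (1 + εR) ^ 2 * ‖((η : ℂ))⁻¹‖ ^ 2 * d * ρ) /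
      (μ * (1 - ρ) - (2 * (2 + εR) * ‖((η : ℂ))⁻¹‖ ^ 2 * d * εR + 4 * (1 + εR) ^ 2 * ‖((η : ℂ))⁻¹‖ ^ 2 * d * ρ)) ≤
      4 * (6 * ‖((η : ℂ))⁻¹‖ ^ 2 * d * KR + 16 * ‖((η : ℂ))⁻¹‖ ^ 2 * d * CS) * (ε + ρ' + δQ) / μ := by
    have hnum : 0 ≤ 2 * (2 * (2 + εR) * ‖((η : ℂ))⁻¹‖ ^ 2 * d * εR + 4 * (1 + εR) ^ 2 * ‖((η : ℂ))⁻¹‖ ^ 2 * d * ρ) := by positivity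
    calc _ ≤ 2 * (2 * (2 + εR) * ‖((η : ℂ))⁻¹‖ ^ 2 * d * εR + 4 * (1 + εR) ^ 2 * ‖((η : ℂ))⁻¹‖ ^ 2 * d * ρ) / (μ / 2) :=
          div_le_div_of_nonneg_left hnum (by positivity) hν2
      _ = 4 * (2 * (2 + εR) * ‖((η : ℂ))⁻¹‖ ^ 2 * d * εR + 4 * (1 + εR) ^ 2 * ‖((η : ℂ))⁻¹‖ ^ 2 * d * ρ) / μ := by
          field_simp; ring
      _ ≤ 4 * (6 * ‖((η : ℂ))⁻¹‖ ^ 2 * d * KR * (ε + ρ' + δQ) + 16 * ‖((η : ℂ))⁻¹‖ ^ 2 * d * CS * (ε + ρ' + δQ)) / μ := by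
          gcongr
      _ = 4 * (6 * ‖((η : ℂ))⁻¹‖ ^ 2 * d * KR + 16 * ‖((η : ℂ))⁻¹‖ ^ 2 * d * CS) * (ε + ρ' + δQ) / μ := by ring
  -- the four pieces against `K·t`
  have hP' : 16 * d * (2 + εR) * ‖((η : ℂ))⁻¹‖ ^ 2 * εR ≤ 48 * d * ‖((η : ℂ))⁻¹‖ ^ 2 * KR * (ε + ρ' + δQ) := by
    have h1 : 2 + εR ≤ 3 := by linarith
    calc 16 * d * (2 + εR) * ‖((η : ℂ))⁻¹‖ ^ 2 * εR = (16 * d * ‖((η : ℂ))⁻¹‖ ^ 2) * ((2 + εR) * εR) := by ring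
      _ ≤ (16 * d * ‖((η : ℂ))⁻¹‖ ^ 2) * (3 * (KR * (ε + ρ' + δQ))) :=
          mul_le_mul_of_nonneg_left (mul_le_mul h1 hεRt hεR (by norm_num)) (by positivity)
      _ = 48 * d * ‖((η : ℂ))⁻¹‖ ^ 2 * KR * (ε + ρ' + δQ) := by ring
  have hD' : 2 * (2 * (1 + εR) * ‖((η : ℂ))⁻¹‖ * Real.sqrt d) * (‖((η : ℂ))⁻¹‖ * εR * Real.sqrt d) ≤ 8 * ‖((η : ℂ))⁻¹‖ ^ 2 * d * KR * (ε + ρ' + δQ) := by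
    have h1 : 1 + εR ≤ 2 := by linarith
    calc 2 * (2 * (1 + εR) * ‖((η : ℂ))⁻¹‖ * Real.sqrt d) * (‖((η : ℂ))⁻¹‖ * εR * Real.sqrt d) = 4 * ‖((η : ℂ))⁻¹‖ ^ 2 * (Real.sqrt d * Real.sqrt d) * ((1 + εR) * εR) := by ring
      _ = 4 * ‖((η : ℂ))⁻¹‖ ^ 2 * d * ((1 + εR) * εR) := by rw [hsd]
      _ ≤ 4 * ‖((η : ℂ))⁻¹‖ ^ 2 * d * (2 * (KR * (ε + ρ' + δQ))) :=
          mul_le_mul_of_nonneg_left (mul_le_mul h1 hεRt hεR (by norm_num)) (by positivity)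
      _ = 8 * ‖((η : ℂ))⁻¹‖ ^ 2 * d * KR * (ε + ρ' + δQ) := by ring
  have hR' : (2 * (1 + εR) * ‖((η : ℂ))⁻¹‖ * Real.sqrt d) ^ 2 *
      (2 * (2 * (2 + εR) * ‖((η : ℂ))⁻¹‖ ^ 2 * d * εR + 4 * (1 + εR) ^ 2 * ‖((η : ℂ))⁻¹‖ ^ 2 * d * ρ) /
        (μ * (1 - ρ) - (2 * (2 + εR) * ‖((η : ℂ))⁻¹‖ ^ 2 * d * εR + 4 * (1 + εR) ^ 2 * ‖((η : ℂ))⁻¹‖ ^ 2 * d * ρ))) ≤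
      64 * ‖((η : ℂ))⁻¹‖ ^ 2 * d * (6 * ‖((η : ℂ))⁻¹‖ ^ 2 * d * KR + 16 * ‖((η : ℂ))⁻¹‖ ^ 2 * d * CS) / μ * (ε + ρ' + δQ) := by
    have hsq : (2 * (1 + εR) * ‖((η : ℂ))⁻¹‖ * Real.sqrt d) ^ 2 = 4 * (1 + εR) ^ 2 * ‖((η : ℂ))⁻¹‖ ^ 2 * d := by
      rw [show (2 * (1 + εR) * ‖((η : ℂ))⁻¹‖ * Real.sqrt d) ^ 2 = 4 * (1 + εR) ^ 2 * ‖((η : ℂ))⁻¹‖ ^ 2 * (Real.sqrt d * Real.sqrt d) by ring, hsd]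
    rw [hsq]
    have hδR0 : 0 ≤ 2 * (2 * (2 + εR) * ‖((η : ℂ))⁻¹‖ ^ 2 * d * εR + 4 * (1 + εR) ^ 2 * ‖((η : ℂ))⁻¹‖ ^ 2 * d * ρ) /
        (μ * (1 - ρ) - (2 * (2 + εR) * ‖((η : ℂ))⁻¹‖ ^ 2 * d * εR + 4 * (1 + εR) ^ 2 * ‖((η : ℂ))⁻¹‖ ^ 2 * d * ρ)) := div_nonneg (by positivity) hν.le
    calc 4 * (1 + εR) ^ 2 * ‖((η : ℂ))⁻¹‖ ^ 2 * d * (2 * (2 * (2 + εR) * ‖((η : ℂ))⁻¹‖ ^ 2 * d * εR + 4 * (1 + εR) ^ 2 * ‖((η : ℂ))⁻¹‖ ^ 2 * d * ρ) /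
          (μ * (1 - ρ) - (2 * (2 + εR) * ‖((η : ℂ))⁻¹‖ ^ 2 * d * εR + 4 * (1 + εR) ^ 2 * ‖((η : ℂ))⁻¹‖ ^ 2 * d * ρ)))
        ≤ 16 * ‖((η : ℂ))⁻¹‖ ^ 2 * d * (4 * (6 * ‖((η : ℂ))⁻¹‖ ^ 2 * d * KR + 16 * ‖((η : ℂ))⁻¹‖ ^ 2 * d * CS) * (ε + ρ' + δQ) / μ) :=
          mul_le_mul hM16 hδR hδR0 (by positivity)
      _ = 64 * ‖((η : ℂ))⁻¹‖ ^ 2 * d * (6 * ‖((η : ℂ))⁻¹‖ ^ 2 * d * KR + 16 * ‖((η : ℂ))⁻¹‖ ^ 2 * d * CS) / μ * (ε + ρ' + δQ) := by ring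
  have hQ'' : |a| * δQ * (2 * MQ + δQ) ≤ |a| * (2 * MQ + 1) * (ε + ρ' + δQ) := by
    have h1 : 2 * MQ + δQ ≤ 2 * MQ + 1 := by linarith
    calc |a| * δQ * (2 * MQ + δQ) = |a| * (δQ * (2 * MQ + δQ)) := by ring
      _ ≤ |a| * ((ε + ρ' + δQ) * (2 * MQ + 1)) :=
          mul_le_mul_of_nonneg_left (mul_le_mul hδQt h1 (by positivity) (by positivity)) (abs_nonneg a)
      _ = |a| * (2 * MQ + 1) * (ε + ρ' + δQ) := by ring
  have hδ : 16 * d * (2 + εR) * ‖((η : ℂ))⁻¹‖ ^ 2 * εR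
      + 2 * (2 * (1 + εR) * ‖((η : ℂ))⁻¹‖ * Real.sqrt d) * (‖((η : ℂ))⁻¹‖ * εR * Real.sqrt d)
      + (2 * (1 + εR) * ‖((η : ℂ))⁻¹‖ * Real.sqrt d) ^ 2 *
        (2 * (2 * (2 + εR) * ‖((η : ℂ))⁻¹‖ ^ 2 * d * εR + 4 * (1 + εR) ^ 2 * ‖((η : ℂ))⁻¹‖ ^ 2 * d * ρ) /
          (μ * (1 - ρ) - (2 * (2 + εR) * ‖((η : ℂ))⁻¹‖ ^ 2 * d * εR + 4 * (1 + εR) ^ 2 * ‖((η : ℂ))⁻¹‖ ^ 2 * d * ρ)))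
      + |a| * δQ * (2 * MQ + δQ) ≤ K * (ε + ρ' + δQ) := by
    have hKsum : 48 * d * ‖((η : ℂ))⁻¹‖ ^ 2 * KR * (ε + ρ' + δQ) + 8 * ‖((η : ℂ))⁻¹‖ ^ 2 * d * KR * (ε + ρ' + δQ)
        + 64 * ‖((η : ℂ))⁻¹‖ ^ 2 * d * (6 * ‖((η : ℂ))⁻¹‖ ^ 2 * d * KR + 16 * ‖((η : ℂ))⁻¹‖ ^ 2 * d * CS) / μ * (ε + ρ' + δQ) + |a| * (2 * MQ + 1) * (ε + ρ' + δQ)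
        + 1 * (ε + ρ' + δQ) = K * (ε + ρ' + δQ) := by rw [hKdef]; ring
    have h1t : 0 ≤ 1 * (ε + ρ' + δQ) := by positivity
    calc _ ≤ 48 * d * ‖((η : ℂ))⁻¹‖ ^ 2 * KR * (ε + ρ' + δQ) + 8 * ‖((η : ℂ))⁻¹‖ ^ 2 * d * KR * (ε + ρ' + δQ)
        + 64 * ‖((η : ℂ))⁻¹‖ ^ 2 * d * (6 * ‖((η : ℂ))⁻¹‖ ^ 2 * d * KR + 16 * ‖((η : ℂ))⁻¹‖ ^ 2 * d * CS) / μ * (ε + ρ' + δQ)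
        + |a| * (2 * MQ + 1) * (ε + ρ' + δQ) := add_le_add (add_le_add (add_le_add hP' hD') hR') hQ''
      _ ≤ _ + 1 * (ε + ρ' + δQ) := le_add_of_nonneg_right h1t
      _ = K * (ε + ρ' + δQ) := hKsum
  exact (norm_principalGF_sub_flat_le L m hL φ η a U hα1 hU1 hreg hεR hρ0 hδQ hMQ hμ hR hRS hmod hρ hQ hQ₁ hν x).trans
    (mul_le_mul_of_nonneg_right hδ (norm_nonneg _))

/-! ## §2 (3.84) for the chain's ASSEMBLED `Δ_a(U)`: `‖Δ_a(U) − Δ_a(1)‖ ≤ C_Δ·ε` at every small field -/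

section Assembled

variable [StarRing 𝔸] [NormedStarGroup 𝔸] [StarModule ℂ 𝔸]

/-- **(3.84) «Δ_a(U′U) = Δ_a(U) − V(A)» WITH `‖V‖ = O(ε)` FOR THE CHAIN'S ASSEMBLED `Δ_a` AT THE FLAT POINT**: there are `C_Δ, ε₆ > 0` (finite-lattice
numbers) such that for EVERY background `U` of E162's data with `‖U(b) − 1‖ ≤ ε ≤ ε₆` and `hRS`: `‖Δ_a(U)x − Δ_a(1)x‖ ≤ C_Δ·ε·‖x‖` — §1 with the
averaging letters DISCHARGED (`ρ′` by NE9 leaf-03's `B9Eq319QprimeLipschitz`, `δ_Q` by NE9 leaf-04's `B9Eq315QLipschitz`, `εR = 2M_φM_φ′ε`) plus the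
curvature part `‖Δ′(U)x‖ ≤ 128d·C_τM_φ²(|η|^d/c₀)|η|⁻²·ε‖x‖` (`B9Ineq369CurvatureOperatorBound`, `Δ′(1) = 0`).
[cite: Balaban1985BackgroundPropagators, (3.82)–(3.84) p.407, (3.69) p.404, (3.26) p.395] -/
theorem exists_laplaceAofBackground_sub_flat_le {η : ℝ} (hη : η ≠ 0) (a : ℝ) {Mφ Mφ' : ℝ} (hMφ : 0 ≤ Mφ) (hMφ' : 0 ≤ Mφ')
    (hφ : ∀ w, ‖φ w‖ ≤ Mφ * ‖w‖) (hφ' : ∀ X, ‖φ.symm X‖ ≤ Mφ' * ‖X‖) (τ : 𝔸 →ₗ[ℂ] ℂ) {Cτ : ℝ} (hτ : ∀ X, ‖τ X‖ ≤ Cτ * ‖X‖) (hCτ : 0 ≤ Cτ) :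
    ∃ CΔ ε₆ : ℝ, 0 < CΔ ∧ 0 < ε₆ ∧ ∀ (U : Bond d (fineP L m) → 𝔸ˣ) {α : ℝ} (hα1 : α ≤ 1 / 64)
      (hU1 : ∀ (x : B7Prop1Explicit.Site d) (κ : Fin d), perCfg (fineP L m) U x κ ∈ U1 𝔸)
      (hreg : ∀ (y : TSite d m) (κ : Fin d) (r : Fin d → Fin L), ‖((Wcx L (perCfg (fineP L m) U) (cornerSite L y) κ (boxVec L r) : 𝔸ˣ) : 𝔸) - 1‖ ≤ α)
      {ε : ℝ}, 0 ≤ ε → ε ≤ ε₆ → (∀ b, ‖(U b : 𝔸) - 1‖ ≤ ε) →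
      (∀ (b : Bond d (fineP L m)) (v u : W), ⟪adTransportW φ U b v, u⟫_ℂ = ⟪v, adTransportW φ (fun b => (U b)⁻¹) b u⟫_ℂ) →
      ∀ x : BondL2K ℂ d (fineP L m) c₀ W,
        ‖laplaceAofBackground L m hL φ U hα1 hU1 hreg τ η (c₀ := c₀) (c₁ := c₁) a x -
          laplaceAofBackground L m hL φ (fun _ => 1) (show (0 : ℝ) ≤ 1 / 64 by norm_num) (hU1_one L m) (hreg_one L m) τ η (c₀ := c₀) (c₁ := c₁) a x‖ ≤
        CΔ * ε * ‖x‖ := by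
  have hc₀ : 0 < c₀ := Fact.out
  obtain ⟨K, ε₀, hK, hε₀, HP⟩ := exists_principalGF_sub_flat_linear L m hL φ (c₀ := c₀) (c₁ := c₁) hη a hMφ hMφ' hφ hφ'
  -- the three linear rates (as in `B9Thm311SmallFieldClosed`): `εR = KR·ε`, `ρ′ ≤ Cρ·εR`, `δ_Q = CQ·ε`; the curvature rate `Kc`
  obtain ⟨KR, hKRdef⟩ : ∃ KR : ℝ, KR = 2 * Mφ * Mφ' := ⟨_, rfl⟩
  have hKR : 0 ≤ KR := by rw [hKRdef]; positivity
  obtain ⟨Cρ, hCρdef⟩ : ∃ Cρ : ℝ, Cρ = (d * (L - 1) : ℕ) * 2 ^ (d * (L - 1)) * (Real.sqrt c₀)⁻¹ := ⟨_, rfl⟩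
  have hCρ : 0 ≤ Cρ := by rw [hCρdef]; positivity
  obtain ⟨CQ, hCQdef⟩ : ∃ CQ : ℝ, CQ = Mφ' * Mφ * Real.sqrt (c₁ * Fintype.card (Bond d m) / c₀) * (102 * (d + 1) ^ 2 * L) := ⟨_, rfl⟩
  have hCQ : 0 ≤ CQ := by rw [hCQdef]; positivity
  obtain ⟨Kc, hKcdef⟩ : ∃ Kc : ℝ, Kc = 32 * d * Cτ * Mφ ^ 2 * (|η| ^ d / c₀) * (‖((η : ℂ))⁻¹‖ ^ 2 * 4) := ⟨_, rfl⟩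
  have hKc : 0 ≤ Kc := by rw [hKcdef]; positivity
  refine ⟨K * (1 + Cρ * KR + CQ) + Kc + 1, min (1 / (KR + 1)) (ε₀ / (1 + Cρ * KR + CQ)), by positivity, by positivity, ?_⟩
  intro U α hα1 hU1 hreg ε hε hε₆ hUε hRS x
  have ht1 : ε ≤ 1 / (KR + 1) := hε₆.trans (min_le_left _ _)
  have ht2 : ε ≤ ε₀ / (1 + Cρ * KR + CQ) := hε₆.trans (min_le_right _ _)
  have hUb : ∀ b : Bond d (fineP L m), U b ∈ U1 𝔸 := fun b => by
    obtain ⟨y, κ⟩ := b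
    have h := hU1 (liftSite y) κ
    rwa [B9Eq315QTorus.perCfg_apply, perSite_liftSite] at h
  have hUb' : ∀ b : Bond d (fineP L m), ‖(U b : 𝔸)‖ ≤ 1 ∧ ‖(((U b)⁻¹ : 𝔸ˣ) : 𝔸)‖ ≤ 1 := fun b => B7Prop1Explicit.mem_U1.1 (hUb b)
  have hR : ∀ (b : Bond d (fineP L m)) (w : W), ‖adTransportW φ U b w - w‖ ≤ KR * ε * ‖w‖ := fun b w => by
    have h := norm_adTransportW_sub_le φ hφ hφ' hMφ' U b (hUb b) (hUε b) w
    rw [hKRdef]; linarith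
  have hεR0 : 0 ≤ KR * ε := by positivity
  -- (ρ′) by NE9 leaf-03
  have hρ' : (1 + KR * ε) ^ (d * (L - 1)) - 1 ≤ Cρ * Real.sqrt c₀ * (KR * ε) := by
    have h := rho_le L (d := d) hεR0
    have hεR1 : KR * ε ≤ 1 := by
      refine (mul_le_mul_of_nonneg_left ht1 hKR).trans ?_
      rw [mul_one_div, div_le_one (by positivity)]; linarith
    have h2 : (1 + KR * ε) ^ (d * (L - 1)) ≤ 2 ^ (d * (L - 1)) := pow_le_pow_left₀ (by positivity) (by linarith) _
    have hs : Cρ * Real.sqrt c₀ = (d * (L - 1) : ℕ) * 2 ^ (d * (L - 1)) := by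
      rw [hCρdef, mul_assoc, inv_mul_cancel₀ (Real.sqrt_pos.2 hc₀).ne', mul_one]
    rw [hs]
    calc (1 + KR * ε) ^ (d * (L - 1)) - 1 ≤ (d * (L - 1) : ℕ) * (KR * ε) * (1 + KR * ε) ^ (d * (L - 1)) := h
      _ ≤ (d * (L - 1) : ℕ) * (KR * ε) * 2 ^ (d * (L - 1)) := mul_le_mul_of_nonneg_left h2 (by positivity)
      _ = (d * (L - 1) : ℕ) * 2 ^ (d * (L - 1)) * (KR * ε) := by ring
  have hQ' : ∀ l : SiteL2K ℂ d (fineP L m) c₀ W,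
      ‖QprimeW L m φ U l - QprimeW L m φ (fun _ : Bond d (fineP L m) => (1 : 𝔸ˣ)) l‖ ≤ Cρ * (KR * ε) * ‖l‖ := fun l => by
    refine (norm_QprimeW_sub_flat_le_L2 L m φ U hεR0 hR l).trans ?_
    rw [← mul_assoc]
    refine mul_le_mul_of_nonneg_right ?_ (norm_nonneg _)
    have hs0 : 0 < Real.sqrt c₀ := Real.sqrt_pos.2 hc₀
    calc ((1 + KR * ε) ^ (d * (L - 1)) - 1) * (Real.sqrt c₀)⁻¹ ≤ (Cρ * Real.sqrt c₀ * (KR * ε)) * (Real.sqrt c₀)⁻¹ :=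
          mul_le_mul_of_nonneg_right hρ' (by positivity)
      _ = Cρ * (KR * ε) := by field_simp
  -- (δ_Q) by NE9 leaf-04
  have hQ : ∀ y : BondL2K ℂ d (fineP L m) c₀ W, ‖QtorusW L m hL φ U hα1 hU1 hreg (c₁ := c₁) y -
      QtorusW L m hL φ (fun _ => 1) (show (0 : ℝ) ≤ 1 / 64 by norm_num) (hU1_one L m) (hreg_one L m) (c₁ := c₁) y‖ ≤ CQ * ε * ‖y‖ := fun y => by
    refine (norm_QtorusW_sub_flat_le L m hL U hα1 hU1 hreg (show (0 : ℝ) ≤ 1 / 64 by norm_num) (hU1_one L m) (hreg_one L m) hε hUε φ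
      hMφ hφ hMφ' hφ' y).trans (le_of_eq ?_)
    rw [hCQdef]; ring
  -- the budget `ε + ρ′ + δ_Q = (1 + CρKR + CQ)·ε ≤ ε₀`
  have ht_eq : ε + Cρ * (KR * ε) + CQ * ε = (1 + Cρ * KR + CQ) * ε := by ring
  have hbudget : ε + Cρ * (KR * ε) + CQ * ε ≤ ε₀ := by
    rw [ht_eq]
    have := mul_le_mul_of_nonneg_left ht2 (by positivity : (0 : ℝ) ≤ 1 + Cρ * KR + CQ)
    rwa [mul_div_cancel₀ _ (by positivity : (1 + Cρ * KR + CQ) ≠ 0)] at this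
  -- the principal part
  have hP := HP U hα1 hU1 hreg hε (by positivity) (by positivity) hbudget hUb hUε hRS hQ' hQ x
  rw [ht_eq] at hP
  -- the curvature part
  have hpl : ∀ p : B9SectCLatticeCarrier.Plaq d (fineP L m), ‖(plaqHolU U p : 𝔸) - 1‖ ≤ 4 * ε := norm_plaqHolU_sub_one_le hUb hUε
  have hC : ‖curvOp φ τ η U x‖ ≤ Kc * ε * ‖x‖ := by
    refine (norm_curvOp_le φ hτ hCτ hφ η hUb' hpl hMφ (by positivity) x).trans (le_of_eq ?_)
    rw [hKcdef]; ring
  -- the decomposition `Δ_a(U) − Δ_a(1) = (P(U) − P(1)) + Δ′(U)` (`Δ′(1) = 0`)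
  have hU_eq : laplaceAofBackground L m hL φ U hα1 hU1 hreg τ η (c₀ := c₀) (c₁ := c₁) a x =
      laplaceALatticeK ((η : ℂ))⁻¹ (adTransportW φ U) (adTransportW φ fun b => (U b)⁻¹) (principalOpK φ η U) (RofU L m φ η U)
        (QtorusW L m hL φ U hα1 hU1 hreg (c₁ := c₁)) a x + curvOp φ τ η U x := by
    show laplaceALatticeK ((η : ℂ))⁻¹ (adTransportW φ U) (adTransportW φ fun b => (U b)⁻¹) (hessOp φ η U τ) (RofU L m φ η U)
        (QtorusW L m hL φ U hα1 hU1 hreg (c₁ := c₁)) a x = _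
    simp only [laplaceALatticeK, laplaceAK_apply, hessOp_apply]
    abel
  have h1_eq : laplaceAofBackground L m hL φ (fun _ => 1) (show (0 : ℝ) ≤ 1 / 64 by norm_num) (hU1_one L m) (hreg_one L m) τ η (c₀ := c₀) (c₁ := c₁) a x =
      laplaceALatticeK ((η : ℂ))⁻¹ (adTransportW φ (fun _ : Bond d (fineP L m) => (1 : 𝔸ˣ)))
        (adTransportW φ fun _ : Bond d (fineP L m) => (1 : 𝔸ˣ)⁻¹) (principalOpK φ η fun _ => 1) (RofU L m φ η fun _ => 1)
        (QtorusW L m hL φ (fun _ => 1) (show (0 : ℝ) ≤ 1 / 64 by norm_num) (hU1_one L m) (hreg_one L m) (c₁ := c₁)) a x := by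
    show laplaceALatticeK ((η : ℂ))⁻¹ (adTransportW φ (fun _ : Bond d (fineP L m) => (1 : 𝔸ˣ)))
        (adTransportW φ fun _ : Bond d (fineP L m) => (1 : 𝔸ˣ)⁻¹) (hessOp φ η (fun _ => 1) τ) (RofU L m φ η fun _ => 1)
        (QtorusW L m hL φ (fun _ => 1) (show (0 : ℝ) ≤ 1 / 64 by norm_num) (hU1_one L m) (hreg_one L m) (c₁ := c₁)) a x = _
    rw [B9Eq310HessianOperator.hessOp_one]
  rw [hU_eq, h1_eq, add_sub_right_comm]
  calc _ ≤ ‖laplaceALatticeK ((η : ℂ))⁻¹ (adTransportW φ U) (adTransportW φ fun b => (U b)⁻¹) (principalOpK φ η U) (RofU L m φ η U)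
            (QtorusW L m hL φ U hα1 hU1 hreg (c₁ := c₁)) a x -
          laplaceALatticeK ((η : ℂ))⁻¹ (adTransportW φ (fun _ : Bond d (fineP L m) => (1 : 𝔸ˣ)))
            (adTransportW φ fun _ : Bond d (fineP L m) => (1 : 𝔸ˣ)⁻¹) (principalOpK φ η fun _ => 1) (RofU L m φ η fun _ => 1)
            (QtorusW L m hL φ (fun _ => 1) (show (0 : ℝ) ≤ 1 / 64 by norm_num) (hU1_one L m) (hreg_one L m) (c₁ := c₁)) a x‖ +
        ‖curvOp φ τ η U x‖ := norm_add_le _ _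
    _ ≤ K * ((1 + Cρ * KR + CQ) * ε) * ‖x‖ + Kc * ε * ‖x‖ := add_le_add hP hC
    _ ≤ (K * (1 + Cρ * KR + CQ) + Kc + 1) * ε * ‖x‖ := by nlinarith [norm_nonneg x]

end Assembled

end Literature.MathematicalPhysics.QuantumFieldTheory.Balaban1983to89.B9Eq384LaplaceALipschitz

end
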